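import Mathlib
import Summits.ValiantsHypothesis.ValiantsHypothesis.Theorems.BinomialElusiveBinomialMapsElusiveDeepToric

/-!
# Crux `BinomialElusive.BinomialMapsElusive` (stmt-ValiantsHypothesis-7393) — honest coordinates:
# exact orders must COLLIDE

Continuation of `BinomialElusiveBinomialMapsElusiveDeepToric` (no deep-toric local swallower), whose small helpers (`decompose`, `orderTop_target`, `aeval_monomial_eq_smul_prod`) are reused.
Same local setting: series `p_j` (`j ∈ σ`) in a Hahn-series field of characteristic `0` and binomial
identities `U_i + V_i = t^{e_i} + t^{e_i + g_i}` with `U_i = α_i p^{A_i}`, `V_i = β_i p^{B_i}`,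
`g_i > 0`.  A coordinate is HONEST (with `A_i` the lower monomial) if `V_i = 0` or
`ord V_i > e_i`.  For an honest coordinate the principal-unit monomial `w^{A_i}` satisfies
`w^{A_i} - 1 = t^{g_i} - t^{-e_i} V_i`; its order `ε_i := ord(t^{g_i} - t^{-e_i} V_i)` is the
coordinate's EXACT ORDER (`= min(g_i, d_i)` for depth `d_i = ord V_i - e_i ≠ g_i`).

**Theorem `card_le_of_honest_orderTop_injective`**: if all coordinates are honest, none is a pure
monomial substitution (`V_i ≠ t^{e_i + g_i}`), and the exact orders `ε_i` are pairwise distinct,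
then `#coordinates ≤ #variables`.  Equivalently, an all-honest local binomial swallower from fewer
variables than coordinates has a monomial-substitution coordinate or two coordinates with the SAME
exact order — since the gaps `g_i` of the E-curve are pairwise distinct, the collision involves a
depth: `d_i = d_j` or `d_i = g_j` (structure note `Cruxes/BinomialMapsElusive/STRUCTURE-p1.md`,
(F2)(ii)).  `card_le_of_deepToric` is the special case `ε_i = g_i`.  Crux-vocabulary wrapper:
`le_of_honest_aeval`.
-/

-- layout Summits/ValiantsHypothesis/ValiantsHypothesis forces the duplicated namespace component
set_option linter.dupNamespace false

namespace Summit.ValiantsHypothesis.ValiantsHypothesis.Theorems.BinomialMapsElusiveHonestCollision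

open scoped BigOperators
open Finset
open Summit.ValiantsHypothesis.ValiantsHypothesis.Theorems.BinomialMapsElusiveExactOrders
open Summit.ValiantsHypothesis.ValiantsHypothesis.Theorems.BinomialMapsElusiveDeepToric

variable {Δ : Type*} [AddCommGroup Δ] [LinearOrder Δ] [IsOrderedAddMonoid Δ]
  {R : Type*} [Field R]

variable [CharZero R]

/-- **Honest coordinates have colliding exact orders.**  Series `p_j` (`j ∈ σ`) and binomial
identities `α_i p^{A_i} + β_i p^{B_i} = t^{e_i} + t^{e_i + g_i}` (`g_i > 0`), all honest
(`β_i p^{B_i} = 0` or of order `> e_i`), none a monomial substitution (`β_i p^{B_i} ≠ t^{e_i+g_i}`),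
with pairwise distinct exact orders `ord(t^{g_i} - t^{-e_i} β_i p^{B_i})`: then `|ι| ≤ |σ|`. -/
theorem card_le_of_honest_orderTop_injective {σ ι : Type*} [Fintype σ] [Fintype ι]
    (p : σ → HahnSeries Δ R) (A B : ι → σ → ℕ) (α β : ι → R) (e g : ι → Δ)
    (hg0 : ∀ i, 0 < g i)
    (hsol : ∀ i, α i • ∏ j, p j ^ A i j + β i • ∏ j, p j ^ B i j =
      HahnSeries.single (e i) 1 + HahnSeries.single (e i + g i) 1)
    (hhonest : ∀ i, β i • ∏ j, p j ^ B i j = 0 ∨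
      ((e i : Δ) : WithTop Δ) < (β i • ∏ j, p j ^ B i j).orderTop)
    (hmono : ∀ i, β i • ∏ j, p j ^ B i j ≠ HahnSeries.single (e i + g i) 1)
    (hinj : Function.Injective fun i =>
      (HahnSeries.single (g i) (1 : R) - HahnSeries.single (-e i) 1 * (β i • ∏ j, p j ^ B i j)).orderTop) :
    Fintype.card ι ≤ Fintype.card σ := by
  classical
  -- notation
  set T : ι → HahnSeries Δ R := fun i => HahnSeries.single (e i) 1 + HahnSeries.single (e i + g i) 1
    with hT
  set U : ι → HahnSeries Δ R := fun i => α i • ∏ j, p j ^ A i j with hU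
  set V : ι → HahnSeries Δ R := fun i => β i • ∏ j, p j ^ B i j with hV
  have hT_ord : ∀ i, (T i).orderTop = e i := fun i => orderTop_target (hg0 i)
  have hV_ord : ∀ i, ((e i : Δ) : WithTop Δ) < (V i).orderTop := fun i => by
    rcases hhonest i with h | h
    · rw [show V i = 0 from h, HahnSeries.orderTop_zero]; exact WithTop.coe_lt_top _
    · exact h
  have hUeq : ∀ i, U i = T i + -V i := fun i => by
    rw [← sub_eq_add_neg, eq_sub_iff_add_eq]; exact hsol i
  have hU_ord : ∀ i, (U i).orderTop = e i := fun i => by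
    rw [hUeq, HahnSeries.orderTop_add_eq_left (by rw [hT_ord, HahnSeries.orderTop_neg]; exact hV_ord i),
      hT_ord]
  have hU_ne : ∀ i, U i ≠ 0 := fun i h => by
    have := hU_ord i; rw [h, HahnSeries.orderTop_zero] at this; exact WithTop.top_ne_coe this
  have hU_coeff : ∀ i, (U i).coeff (e i) = 1 := fun i => by
    rw [hUeq, HahnSeries.coeff_add, HahnSeries.coeff_neg,
      HahnSeries.coeff_eq_zero_of_lt_orderTop (hV_ord i), neg_zero, add_zero, hT,
      HahnSeries.coeff_add, HahnSeries.coeff_single_same, HahnSeries.coeff_single_of_ne, add_zero]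
    exact ne_of_lt (lt_add_of_pos_right _ (hg0 i))
  -- every variable occurring in some `A_i` is nonzero; decompose all nonzero `p_j`
  have hp_ne : ∀ i j, A i j ≠ 0 → p j ≠ 0 := fun i j hA hpj => by
    apply hU_ne i
    simp only [hU]
    rw [Finset.prod_eq_zero (Finset.mem_univ j) (by rw [hpj, zero_pow hA]), smul_zero]
  set ν : σ → Δ := fun j => (p j).order with hν
  set c : σ → R := fun j => if p j = 0 then 1 else (p j).leadingCoeff with hc
  set w : σ → HahnSeries Δ R := fun j =>
    if p j = 0 then 1 else HahnSeries.single (-(p j).order) (p j).leadingCoeff⁻¹ * p j with hw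
  have hw_pr : ∀ j, 0 < (w j - 1).orderTop := fun j => by
    by_cases hpj : p j = 0
    · simp [hw, hpj]
    · simp only [hw, if_neg hpj]; exact (decompose hpj).2
  have hpw : ∀ j, p j ≠ 0 → p j = HahnSeries.single (ν j) (c j) * w j := fun j hpj => by
    simp only [hν, hc, hw, if_neg hpj]; exact (decompose hpj).1
  have hc_ne : ∀ j, c j ≠ 0 := fun j => by
    by_cases hpj : p j = 0
    · simp [hc, hpj]
    · simp only [hc, if_neg hpj]; exact HahnSeries.leadingCoeff_ne_zero.mpr hpj
  have hmono' : ∀ i, ∏ j, p j ^ A i j =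
      HahnSeries.single (∑ j, A i j • ν j) (∏ j, c j ^ A i j) * ∏ j, w j ^ A i j := fun i => by
    have h1 : ∀ j, p j ^ A i j = HahnSeries.single (A i j • ν j) (c j ^ A i j) * w j ^ A i j := by
      intro j
      by_cases hA : A i j = 0
      · simp [hA]
      · rw [hpw j (hp_ne i j hA), mul_pow, HahnSeries.single_pow]
    simp_rw [h1]
    rw [Finset.prod_mul_distrib]
    congr 1
    induction (Finset.univ : Finset σ) using Finset.induction_on with
    | empty => simp
    | insert a s ha ih => rw [Finset.prod_insert ha, Finset.sum_insert ha, Finset.prod_insert ha, ih,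
        HahnSeries.single_mul_single]
  set W : ι → HahnSeries Δ R := fun i => ∏ j, w j ^ A i j with hW
  set κ : ι → R := fun i => α i * ∏ j, c j ^ A i j with hκ
  set E : ι → Δ := fun i => ∑ j, A i j • ν j with hE
  have hW_pr : ∀ i, 0 < (W i - 1).orderTop := fun i =>
    (lt_orderTop_prod_sub_one Finset.univ (fun j => w j ^ A i j)
      (fun j _ => principal_pow (hw_pr j) _) WithTop.zero_ne_top
      (fun j _ => principal_pow (hw_pr j) _)).1
  have hUW : ∀ i, U i = HahnSeries.single (E i) (κ i) * W i := fun i => by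
    simp only [hU, hW, hκ, hE]
    rw [hmono' i, ← HahnSeries.C_mul_eq_smul, ← mul_assoc, HahnSeries.C_apply,
      HahnSeries.single_mul_single, zero_add]
  have hκ_ne : ∀ i, κ i ≠ 0 := fun i => by
    simp only [hκ]
    refine mul_ne_zero ?_ (Finset.prod_ne_zero_iff.mpr fun j _ => pow_ne_zero _ (hc_ne j))
    intro hα; apply hU_ne i; simp [hU, hα]
  have hE_eq : ∀ i, E i = e i := fun i => by
    have h := hU_ord i
    rw [hUW, HahnSeries.orderTop_mul, HahnSeries.orderTop_single (hκ_ne i),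
      orderTop_eq_zero_of_principal (hW_pr i), add_zero] at h
    exact WithTop.coe_injective h
  have hκ_eq : ∀ i, κ i = 1 := fun i => by
    have h := hU_coeff i
    rw [hUW, ← hE_eq i, HahnSeries.coeff_single_mul, sub_self] at h
    have hW0 : (W i).coeff 0 = 1 := by
      have h0 : (W i - 1).coeff 0 = 0 := HahnSeries.coeff_eq_zero_of_lt_orderTop (hW_pr i)
      rw [HahnSeries.coeff_sub, HahnSeries.coeff_one, if_pos rfl, sub_eq_zero] at h0
      exact h0
    rw [hW0, mul_one] at h
    exact h
  -- `W_i = t^{-e_i} U_i = 1 + t^{g_i} - t^{-e_i} V_i`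
  have hWi : ∀ i, W i = 1 + (HahnSeries.single (g i) (1 : R) - HahnSeries.single (-e i) 1 * V i) :=
    fun i => by
    have h1 : W i = HahnSeries.single (-e i) (1 : R) * U i := by
      rw [hUW, hκ_eq, hE_eq, ← mul_assoc, HahnSeries.single_mul_single, neg_add_cancel, mul_one,
        HahnSeries.single_zero_one, one_mul]
    rw [h1, hUeq, hT]
    simp only [mul_add, mul_neg, HahnSeries.single_mul_single, one_mul, neg_add_cancel,
      neg_add_cancel_left, HahnSeries.single_zero_one]
    ring
  -- apply the multiplicative exact-order lemma to the monomials `W_i`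
  have key := card_le_of_orderTop_monomial_injective w hw_pr (fun i j => (A i j : ℤ))
    (fun i => ?_) (fun i i' h => ?_)
  · exact key
  · -- `W_i ≠ 1`: otherwise `V_i = t^{e_i + g_i}`
    simp only [zpow_natCast]
    intro h1
    apply hmono i
    have h2 : HahnSeries.single (g i) (1 : R) - HahnSeries.single (-e i) 1 * V i = 0 := by
      have := hWi i; rw [show (∏ j, w j ^ A i j) = W i from rfl] at h1; rw [h1] at this
      exact (add_eq_left.mp this.symm)
    rw [sub_eq_zero] at h2
    have h3 := congr_arg (fun y => HahnSeries.single (e i) (1 : R) * y) h2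
    simp only [HahnSeries.single_mul_single, ← mul_assoc, add_neg_cancel, mul_one,
      HahnSeries.single_zero_one, one_mul] at h3
    exact h3.symm
  · -- injectivity of the exact orders
    simp only [zpow_natCast] at h
    rw [show (∏ j, w j ^ A i j) = W i from rfl, show (∏ j, w j ^ A i' j) = W i' from rfl,
      hWi i, hWi i', add_sub_cancel_left, add_sub_cancel_left] at h
    exact hinj h

/-- **Crux vocabulary** (`MvPolynomial` monomials, `LaurentSeries` targets `t^{N a_i} + t^{N b_i}`
as produced by `numericToPuiseux_proof`): an all-honest local binomial swallower
`Γ_i = α_i y^{A_i} + β_i y^{B_i}`, `Γ_i(p) = t^{N a_i} + t^{N b_i}` (`a_i < b_i`, `N > 0`, `A_i` the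
lower monomial: `β_i p^{B_i} = 0` or `ord > N a_i`), with no monomial-substitution coordinate and
pairwise distinct exact orders `ord(t^{N(b_i - a_i)} - t^{-N a_i} β_i p^{B_i})`, has `m ≤ s`. -/
theorem le_of_honest_aeval {s m : ℕ} (Γ : Fin m → MvPolynomial (Fin s) R)
    (A B : Fin m → Fin s →₀ ℕ) (α β : Fin m → R)
    (hΓ : ∀ i, Γ i = MvPolynomial.monomial (A i) (α i) + MvPolynomial.monomial (B i) (β i))
    (N : ℕ) (hN : 0 < N) (a b : Fin m → ℕ) (hab : ∀ i, a i < b i) (p : Fin s → LaurentSeries R)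
    (hsol : ∀ i, MvPolynomial.aeval p (Γ i) =
      HahnSeries.single ((N * a i : ℕ) : ℤ) 1 + HahnSeries.single ((N * b i : ℕ) : ℤ) 1)
    (hhonest : ∀ i, MvPolynomial.aeval p (MvPolynomial.monomial (B i) (β i)) = 0 ∨
      (((N * a i : ℕ) : ℤ) : WithTop ℤ) <
        (MvPolynomial.aeval p (MvPolynomial.monomial (B i) (β i))).orderTop)
    (hmono : ∀ i, MvPolynomial.aeval p (MvPolynomial.monomial (B i) (β i)) ≠
      HahnSeries.single ((N * b i : ℕ) : ℤ) 1)
    (hinj : Function.Injective fun i =>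
      (HahnSeries.single (((N * b i : ℕ) : ℤ) - ((N * a i : ℕ) : ℤ)) (1 : R) -
        HahnSeries.single (-((N * a i : ℕ) : ℤ)) 1 *
          MvPolynomial.aeval p (MvPolynomial.monomial (B i) (β i))).orderTop) :
    m ≤ s := by
  have hg0 : ∀ i, (0 : ℤ) < ((N * b i : ℕ) : ℤ) - ((N * a i : ℕ) : ℤ) := fun i => by
    have : N * a i < N * b i := Nat.mul_lt_mul_of_pos_left (hab i) hN
    omega
  have key := card_le_of_honest_orderTop_injective (σ := Fin s) (ι := Fin m) p
    (fun i j => A i j) (fun i j => B i j) α β (fun i => ((N * a i : ℕ) : ℤ))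
    (fun i => ((N * b i : ℕ) : ℤ) - ((N * a i : ℕ) : ℤ)) hg0
    (fun i => by
      rw [← aeval_monomial_eq_smul_prod, ← aeval_monomial_eq_smul_prod, ← map_add, ← hΓ, hsol i,
        add_sub_cancel])
    (fun i => by rw [← aeval_monomial_eq_smul_prod]; exact hhonest i)
    (fun i => by rw [← aeval_monomial_eq_smul_prod, add_sub_cancel]; exact hmono i)
    (fun i i' h => by
      apply hinj
      simp only [← aeval_monomial_eq_smul_prod] at h ⊢
      exact h)
  simpa using key

end Summit.ValiantsHypothesis.ValiantsHypothesis.Theorems.BinomialMapsElusiveHonestCollision
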